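import Literature.AlgebraicGeometry.Motives.AbelianVarietyGoodReductionConjReductionPoint
import Literature.AlgebraicGeometry.Motives.AbelianVarietyConjugateTransport
import Literature.AlgebraicGeometry.Motives.ProperIntegralPointsTwist
import HarnessLib

/-!
# The twisted reduction identity «`(Y^σ)~ = Ỹ^f`» for the Frobenius-conjugate datum, ASSEMBLED modulo the base-point
# Frobenius-translate — [Shimura 1998, §18.6 proof of Thm. 18.6, p. 129]

Topic `Literature/AlgebraicGeometry/Motives`; namespaces `Literature.AlgebraicGeometry.Motives.AbelianVariety.GoodReductionAt` and
`Literature.NumberTheory.DiophantineGeometry.IsAbelianSchemeModel`.  Theorems + ONE hypothesis predicate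
(`GoodReductionAt.SlotT3`, a parametrised `Prop`, NOT a named fact); no instance; net Literature debt 0.  Cell `hodgecm-mathlib` (D-0151), row II-1, edition E4 «S5c′ ↦ Q5 ↦ (TW)», piece P5 (the ASSEMBLY of the
twisted reduction identity; allocator B-p09 2026-08-28T09:27/09:32/10:01Z).  Sequel of `AbelianVarietyGoodReductionReductionMap`
((A), the reduction map `geomReductionMap` of an arbitrary datum), `AbelianVarietyFrobeniusTwistPoints` (first-projection formulas
of the conjugate model), `AbelianVarietyGoodReductionConjReductionPoint` ((P4), «reduction point of the conjugate datum = relative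
Frobenius of the reduction point») and `ProperIntegralPointsTwist` (points of the twisted model).

WHAT IS HERE.  `K ⊇ F₀` number fields, `v` a prime of `K`, `γ ∈ Aut(K/F₀)` an arithmetic Frobenius at `v` (`q = pⁿ`), `γᵥ` the
induced automorphism of `𝓞_{K,v}`, `σ̃ : K̄ ≃+* K̄` over `γ`, `R' : Aₐ.GoodReductionAt v` ANY good-reduction datum (model `𝒳`,
generic isomorphism `e : 𝒳_K ≅ Aₐ`), `R ⊆ Ω = K̄ᵥ` the valuation ring, `ι : K̄ → K̄ᵥ` the chosen embedding.
* (G0) `modelPointsEquiv_symm_left_eq_xi` — the `Ω`-point of `𝒳` attached to `y ∈ Aₐ(K̄)` lies over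
  `ξ_y := y ≫ e⁻¹ ≫ pr₁ : Spec K̄ → 𝒳`; `xi_comp_hom` — `ξ_y` lies over `Spec K̄ → Spec 𝓞ᵥ`.
* `conjFrob_genericIso'_inv_left_comp_fst_fst` — the INVERSE generic isomorphism of the conjugate datum against the two
  projections; (G1) `modelPointsEquiv_symm_conjTransport_left_comp_baseChangeHomFst` — the `Ω`-point of the conjugate model `𝒳 ⊗_{γᵥ} 𝓞ᵥ`
  attached to `y^σ̃ ∈ Aₐ^γ(K̄)` projects onto the `σ̃`-TRANSLATE `Spec ι ≫ Spec σ̃ ≫ ξ_y` (the coordinates of `y^σ̃` are the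
  `σ̃`-conjugates of those of `y`).
* [RED] `reduce_conjTransport_left_comp_fst` — GIVEN the base-point Frobenius-translate property (hypothesis `hT3`, the cell's
  slot (T3″): an `R`-point of `𝒳` over the `γᵥ`-twisted structure map with generic fibre `Spec ι ≫ Spec σ̃ ≫ ξ` reduces to the
  `Frobⁿ`-translate of the reduction of the point over `Spec ι ≫ ξ` — [Shimura1998] p. 129 «`(Y^σ)~ = Ỹ^f`» at the base point,
  proved from the global valuation ring `ℤ̄_(𝔓)` on which `σ̃` acts with residue action `y ↦ y^q`), the «extend then restrict»
  point of the conjugate model at `y^σ̃`, projected to `𝒳`, is `Spec Frobⁿ_{κ(R)}` after the one of `𝒳` at `y`.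
* (TW) `IsAbelianSchemeModel.twistedReductionMap_of_frobeniusTranslate` — for the produced datum of an abelian-scheme model:
  **`red_{(𝒜ₐ-datum)^γ} (y^σ̃) = π (red_v y)`**, `π = F^{(n)}` the relative Frobenius of the special fibre — the hypothesis
  `hTW` of `AbelianVarietyGoodReductionConjFrobTateCompat` (hence the named Q5 / `S5c′`) — modulo `hT3` alone.
No `extendPoint` over the twisted base point `(R, f ∘ γᵥ)` is used (the generic twist lemmas do not instantiate within the
kernel's budget at `O := 𝓞_{K,v}`); the twist enters only through `twistPoint_w'` and `restrictPoint_extendPoint`.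

HC_CM is proved only modulo the 7 printed citations until rung 0 closes.

## References
* [Shimura1998] G. Shimura, *Abelian Varieties with Complex Multiplication and Modular Functions*, Princeton 1998, §18.6 proof of
  Thm. 18.6, pp. 128–130 («`(Y^σ)~ = Ỹ^f` for every object `Y` rational over `L` … `(t^σ)~ = π(t̃)`»); §11.1 Prop. 12, 14.
* [SerreTate1968] J.-P. Serre, J. Tate, *Good reduction of abelian varieties*, Ann. of Math. 88 (1968), §1.
* [Hartshorne1977] R. Hartshorne, *Algebraic Geometry*, II.3 (fibre products), II.4.7 (valuative criterion).
* [GortzWedhorn2020] U. Görtz, T. Wedhorn, *Algebraic Geometry I* (2nd ed.), Prop. 4.16, §(4.7).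
-/

set_option autoImplicit false

-- Compositions through `((baseChangeHom φ).obj X).left = pullback X.hom (Spec φ)` are definitional only above `instances`
-- transparency (cf. `AbelianVarietyGoodReductionConjugate`, `ProperIntegralPointsTwist`).
set_option backward.isDefEq.respectTransparency false

noncomputable section


open CategoryTheory CategoryTheory.Limits AlgebraicGeometry IsDedekindDomain IsDedekindDomain.HeightOneSpectrum
open scoped NumberField
open Literature.NumberTheory.EllipticCurves (genericFibre specGenericPoint)
open Literature.NumberTheory.GaloisRepresentations (closureValuationSubring)
open Literature.NumberTheory.DiophantineGeometry



/-! ## The generic readings, the twisted reduction [RED], and the composition (TW) -/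

namespace Literature.AlgebraicGeometry.Motives

namespace AbelianVariety

namespace GoodReductionAt

open Literature.NumberTheory.GaloisRepresentations (closureValuationSubring absClosureEmbedding absClosureAlgebra)
open Literature.NumberTheory.DiophantineGeometry

variable {F₀ K : Type} [Field F₀] [Field K] [NumberField K] [Algebra F₀ K] {v : HeightOneSpectrum (𝓞 K)}
  {Aₐ : AbelianVariety K} (R' : Aₐ.GoodReductionAt v)

/-! ### (G0) the generic reading of `y ∈ Aₐ(K̄)` as an `Ω`-point of the model -/

/-- `pr₁ : 𝒳_K → 𝒳` in the two spellings (`pullback.fst _ (specGenericPoint _ K)` and `baseChangeHomFst (algebraMap _ K)`)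
agree (by `rfl`). [cite: GortzWedhorn2020, Section (4.7)] -/
theorem pullback_fst_specGenericPoint_eq (𝒳 : SchemeOver (valuationSubringAtPrime K v)) :
    pullback.fst 𝒳.hom (specGenericPoint (valuationSubringAtPrime K v) K) =
      baseChangeHomFst (algebraMap (valuationSubringAtPrime K v) K) 𝒳 := rfl

/-- `B(K̄) → B(K̄ᵥ)` on underlying schemes: `(ι_* P).left = Spec ι ≫ P.left`, `ι : K̄ → K̄ᵥ` the chosen embedding.
[cite: SerreTate1968, §1] -/
private theorem toAdicCompletionPoints_left (B : AbelianVariety K) (P : B.Points (AlgebraicClosure K)) :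
    (toAdicCompletionPoints B v P).left =
      Spec.map (CommRingCat.ofHom (absClosureEmbedding K (v.adicCompletion K)).toRingHom) ≫ P.left := by
  letI := absClosureAlgebra K (v.adicCompletion K)
  change (AlgPoints.extendScalars B.X _ _ P).left = _
  rw [AlgPoints.extendScalars_apply, Over.comp_left, AlgPoints.specOverMap_left]
  rfl

/-- **(G0)** The `Ω`-point of the model `𝒳` attached to `y ∈ Aₐ(K̄)` lies over the `K̄`-point
`ξ_y := y ≫ e⁻¹ ≫ pr₁ : Spec K̄ → Aₐ ≅ 𝒳_K → 𝒳`: `(e⁻¹(ι_* y)).left = Spec ι ≫ ξ_y`.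
[cite: Hartshorne1977, II.3 Thm. 3.3 (fibre product, universal property)] -/
private theorem modelPointsEquiv_symm_left_eq_xi (y : Aₐ.geomPoints) :
    (R'.modelPointsEquiv.symm (toAdicCompletionPoints Aₐ v (Additive.toMul y))).left =
      Spec.map (CommRingCat.ofHom (absClosureEmbedding K (v.adicCompletion K)).toRingHom) ≫
        (Additive.toMul y).left ≫ R'.genericIso'.inv.left ≫
          baseChangeHomFst (algebraMap (valuationSubringAtPrime K v) K) R'.model.total := by
  rw [R'.modelPointsEquiv_symm_left, pullback_fst_specGenericPoint_eq, Over.comp_left, toAdicCompletionPoints_left,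
    Category.assoc, Category.assoc]

/-- The `K̄`-point `ξ_y = y ≫ e⁻¹ ≫ pr₁` of the model lies over `Spec K̄ → Spec 𝓞_{K,v}`. [cite: GortzWedhorn2020, Section (4.7)] -/
theorem xi_comp_hom (y : Aₐ.geomPoints) :
    ((Additive.toMul y).left ≫ R'.genericIso'.inv.left ≫
        baseChangeHomFst (algebraMap (valuationSubringAtPrime K v) K) R'.model.total) ≫ R'.model.total.hom =
      Spec.map (CommRingCat.ofHom (algebraMap (valuationSubringAtPrime K v) (AlgebraicClosure K))) := by
  have hc : baseChangeHomFst (algebraMap (valuationSubringAtPrime K v) K) R'.model.total ≫ R'.model.total.hom =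
      ((genericFibre (valuationSubringAtPrime K v) K).obj R'.model.total).hom ≫
        specGenericPoint (valuationSubringAtPrime K v) K := pullback.condition
  have h1 : R'.genericIso'.inv.left ≫ ((genericFibre (valuationSubringAtPrime K v) K).obj R'.model.total).hom = Aₐ.X.hom :=
    Over.w R'.genericIso'.inv
  have h2 : (Additive.toMul y).left ≫ Aₐ.X.hom = (specOver K (AlgebraicClosure K)).hom := Over.w (Additive.toMul y)
  rw [Category.assoc, Category.assoc, hc, reassoc_of% h1, reassoc_of% h2]
  change Spec.map _ ≫ Spec.map _ = _
  rw [← Spec.map_comp, ← CommRingCat.ofHom_comp, ← IsScalarTower.algebraMap_eq]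

/-! ### (G1) the generic reading of `y^σ̃ ∈ Aₐ^γ(K̄)` as an `Ω`-point of the conjugate model `𝒳 ⊗_{γᵥ} 𝓞ᵥ` -/

variable (γ : K ≃ₐ[F₀] K) (hγ : IsArithFrobAt (𝓞 F₀) γ v.asIdeal) (p n : ℕ) [ExpChar v.asIdeal.ResidueField p]
  (hq : Nat.card (𝓞 F₀ ⧸ v.asIdeal.under (𝓞 F₀)) = p ^ n) (σt : AlgebraicClosure K ≃+* AlgebraicClosure K)
  (hσa : ∀ a : K, σt (algebraMap K (AlgebraicClosure K) a) = algebraMap K (AlgebraicClosure K) (γ.toRingEquiv a))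

/-- The inverse generic isomorphism of the conjugate datum against the two projections to `𝒳`:
`(e^γ)⁻¹ ≫ pr_K ≫ pr_{γᵥ} = pr_γ ≫ e⁻¹ ≫ pr_K` (from A-p14's `conjModel_genericIso_hom_left_comp_fst` and
`conjGenericNatIso_hom_app_left_comp_fst_fst`). [cite: GortzWedhorn2020, Prop. 4.16 and §(4.7)] -/
theorem conjFrob_genericIso'_inv_left_comp_fst_fst :
    (R'.conjFrob γ hγ p n hq).genericIso'.inv.left ≫
        baseChangeHomFst (algebraMap (valuationSubringAtPrime K v) K) (R'.conjFrob γ hγ p n hq).model.total ≫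
          baseChangeHomFst (algEquivValuationSubring v γ (smul_asIdeal_eq_of_isArithFrobAt v γ hγ)).toRingHom
            R'.model.total =
      baseChangeHomFst γ.toRingEquiv.toRingHom Aₐ.X ≫ R'.genericIso'.inv.left ≫
        baseChangeHomFst (algebraMap (valuationSubringAtPrime K v) K) R'.model.total := by
  -- the `hom` direction (A-p14) and the exchange isomorphism against the projections
  have hhom := conjModel_genericIso_hom_left_comp_fst R' γ.toRingEquiv
    (algEquivValuationSubring v γ (smul_asIdeal_eq_of_isArithFrobAt v γ hγ))
    (algebraMap_comp_algEquivValuationSubring v γ _)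
  have hc := conjGenericNatIso_hom_app_left_comp_fst_fst (K := K) (v := v) γ.toRingEquiv
    (algEquivValuationSubring v γ (smul_asIdeal_eq_of_isArithFrobAt v γ hγ))
    (algebraMap_comp_algEquivValuationSubring v γ _) R'.model.total
  have hinv : R'.model.genericIso.hom.left ≫ R'.genericIso'.inv.left = 𝟙 _ := by
    rw [← Over.comp_left]
    exact (congrArg CommaMorphism.left R'.genericIso'.hom_inv_id).trans rfl
  -- `(e^γ).hom.left ≫ (pr_γ ≫ e⁻¹ ≫ pr_K) = pr_K ≫ pr_{γᵥ}`
  have key : (R'.conjFrob γ hγ p n hq).genericIso'.hom.left ≫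
      (baseChangeHomFst γ.toRingEquiv.toRingHom Aₐ.X ≫ R'.genericIso'.inv.left ≫
        baseChangeHomFst (algebraMap (valuationSubringAtPrime K v) K) R'.model.total) =
      baseChangeHomFst (algebraMap (valuationSubringAtPrime K v) K) (R'.conjFrob γ hγ p n hq).model.total ≫
        baseChangeHomFst (algEquivValuationSubring v γ (smul_asIdeal_eq_of_isArithFrobAt v γ hγ)).toRingHom
          R'.model.total := by
    rw [genericIso', conjFrob_model_genericIso, ← Category.assoc, hhom, Category.assoc, Category.assoc,
      reassoc_of% hinv]
    exact hc
  rw [← key, ← Category.assoc _ _ (baseChangeHomFst γ.toRingEquiv.toRingHom Aₐ.X ≫ _), ← Over.comp_left,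
    Iso.inv_hom_id, Over.id_left, Category.id_comp]

/-- **(G1)** The `Ω`-point of the conjugate model attached to `y^σ̃ ∈ Aₐ^γ(K̄)` projects onto the `σ̃`-TRANSLATE of `ξ_y`:
`(e^γ)⁻¹(ι_* y^σ̃).left ≫ pr_{γᵥ} = Spec ι ≫ Spec σ̃ ≫ ξ_y` (A-p04's `conjTransport_left_comp_fst`: the coordinates of `y^σ̃` are
the `σ̃`-conjugates of those of `y`). [cite: Shimura1998, §18.6 proof of Thm. 18.6, p. 129] -/
private theorem modelPointsEquiv_symm_conjTransport_left_comp_baseChangeHomFst (y : Aₐ.geomPoints) :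
    ((R'.conjFrob γ hγ p n hq).modelPointsEquiv.symm
        (toAdicCompletionPoints (Aₐ.conjugate γ.toRingEquiv) v
          (Additive.toMul (conjTransport γ.toRingEquiv σt hσa Aₐ y)))).left ≫
        baseChangeHomFst (algEquivValuationSubring v γ (smul_asIdeal_eq_of_isArithFrobAt v γ hγ)).toRingHom
          R'.model.total =
      Spec.map (CommRingCat.ofHom (absClosureEmbedding K (v.adicCompletion K)).toRingHom) ≫
        Spec.map (CommRingCat.ofHom σt.toRingHom) ≫
          (Additive.toMul y).left ≫ R'.genericIso'.inv.left ≫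
            baseChangeHomFst (algebraMap (valuationSubringAtPrime K v) K) R'.model.total := by
  rw [GoodReductionAt.modelPointsEquiv_symm_left, pullback_fst_specGenericPoint_eq, Over.comp_left,
    toAdicCompletionPoints_left, Category.assoc, Category.assoc, Category.assoc,
    conjFrob_genericIso'_inv_left_comp_fst_fst,
    ← Category.assoc (Additive.toMul (conjTransport γ.toRingEquiv σt hσa Aₐ y)).left,
    conjTransport_left_comp_fst, Category.assoc]

/-! ### The base-point Frobenius-translate predicate and the twisted reduction [RED] -/

/-- **The base-point Frobenius-translate property** (hypothesis predicate of P5; the cell's slot (T3″), φ-light form — for the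
prover, `P′ :=` the restriction of `l` recovers the `extendPoint` form by uniqueness of extensions): for a proper `𝓞ᵥ`-scheme `𝒳`, a `K̄`-valued point
`ξ` of `𝒳` over `𝓞ᵥ`, the `Ω`-point `Q` over `(R, f)` lying over `Spec ι ≫ ξ`, and ANY `R`-valued point `l` of the underlying
scheme of `𝒳` lying over the `φ`-TWISTED structure map `Spec (f ∘ φ)` whose generic fibre is `Spec ι ≫ Spec σ̃ ≫ ξ`, the special
fibre of `l` is the `Frobⁿ`-translate of the reduction of `Q` ([Shimura1998] p. 129 «`(Y^σ)~ = Ỹ^f`» at the base point: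
`σ̃` acts on the valuation ring `ℤ̄_(𝔓) ⊂ K̄` with residue action `y ↦ y^q`). [cite: Shimura1998, §18.6 proof of Thm. 18.6, p. 129] -/
def SlotT3 (v : HeightOneSpectrum (𝓞 K)) (φ : valuationSubringAtPrime K v →+* valuationSubringAtPrime K v)
    (σt : AlgebraicClosure K ≃+* AlgebraicClosure K) (p n : ℕ) : Prop :=
  ∀ [ExpChar (IsLocalRing.ResidueField (closureValuationSubring (v.adicCompletion K))) p]
    (𝒳 : SchemeOver (valuationSubringAtPrime K v)) [GrpObj 𝒳] [IsProper 𝒳.hom]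
    (ξ : Spec (.of (AlgebraicClosure K)) ⟶ 𝒳.left)
    (_hξ : ξ ≫ 𝒳.hom = Spec.map (CommRingCat.ofHom (algebraMap (valuationSubringAtPrime K v) (AlgebraicClosure K))))
    (Q : specFractionField (closureValuationSubring (v.adicCompletion K)) (toClosureValuationSubring v) ⟶ 𝒳)
    (_hQ : Q.left = Spec.map (CommRingCat.ofHom (absClosureEmbedding K (v.adicCompletion K)).toRingHom) ≫ ξ)
    (l : Spec (.of (closureValuationSubring (v.adicCompletion K))) ⟶ 𝒳.left)
    (_hl₁ : l ≫ 𝒳.hom = Spec.map (CommRingCat.ofHom ((toClosureValuationSubring v).comp φ)))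
    (_hl₂ : Spec.map (CommRingCat.ofHom (algebraMap (closureValuationSubring (v.adicCompletion K))
        (AlgebraicClosure (v.adicCompletion K)))) ≫ l =
      Spec.map (CommRingCat.ofHom (absClosureEmbedding K (v.adicCompletion K)).toRingHom) ≫
        Spec.map (CommRingCat.ofHom σt.toRingHom) ≫ ξ),
    Spec.map (CommRingCat.ofHom (IsLocalRing.residue (closureValuationSubring (v.adicCompletion K)))) ≫ l =
      Spec.map (CommRingCat.ofHom (iterateFrobenius
          (IsLocalRing.ResidueField (closureValuationSubring (v.adicCompletion K))) p n)) ≫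
        (specRingHomι (closureValuationSubring (v.adicCompletion K)) (toClosureValuationSubring v)
            (IsLocalRing.residue (closureValuationSubring (v.adicCompletion K))) ≫
          extendPoint (closureValuationSubring (v.adicCompletion K)) (toClosureValuationSubring v) 𝒳 Q).left

/-- **[RED] — the reduction of `y^σ̃` in the conjugate model projects onto the `Frobⁿ`-translate of the reduction of `y`.**
For `y ∈ Aₐ(K̄)` and ANY datum `R'` of `Aₐ` (model `𝒳`), the `κ(R)`-point «extend then restrict» of the conjugate model
`𝒳 ⊗_{γᵥ} 𝓞ᵥ` at `y^σ̃`, projected to `𝒳`, is `Spec Frobⁿ_{κ(R)}` followed by the `κ(R)`-point «extend then restrict» of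
`𝒳` at `y` — from (G0)/(G1), the structure/generic-fibre formulas of the projected extension (`twistPoint_w'` ★ p620854,
`restrictPoint_extendPoint`) and the base-point Frobenius-translate predicate `SlotT3`. [cite: Shimura1998, §18.6 proof of Thm. 18.6, p. 129] -/
theorem reduce_conjTransport_left_comp_fst [GrpObj R'.model.total]
    [ExpChar (IsLocalRing.ResidueField (closureValuationSubring (v.adicCompletion K))) p]
    (hT3 : SlotT3 v (algEquivValuationSubring v γ (smul_asIdeal_eq_of_isArithFrobAt v γ hγ)).toRingHom σt p n)
    (y : Aₐ.geomPoints) :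
    haveI := (R'.conjFrob γ hγ p n hq).isProper_model
    haveI := R'.isProper_model
    (specRingHomι (closureValuationSubring (v.adicCompletion K)) (toClosureValuationSubring v)
          (IsLocalRing.residue (closureValuationSubring (v.adicCompletion K))) ≫
        extendPoint (closureValuationSubring (v.adicCompletion K)) (toClosureValuationSubring v)
          (R'.conjFrob γ hγ p n hq).model.total
          ((R'.conjFrob γ hγ p n hq).modelPointsEquiv.symm
            (toAdicCompletionPoints (Aₐ.conjugate γ.toRingEquiv) v
              (Additive.toMul (conjTransport γ.toRingEquiv σt hσa Aₐ y))))).left ≫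
        baseChangeHomFst (algEquivValuationSubring v γ (smul_asIdeal_eq_of_isArithFrobAt v γ hγ)).toRingHom
          R'.model.total =
      Spec.map (CommRingCat.ofHom (iterateFrobenius
          (IsLocalRing.ResidueField (closureValuationSubring (v.adicCompletion K))) p n)) ≫
        (specRingHomι (closureValuationSubring (v.adicCompletion K)) (toClosureValuationSubring v)
            (IsLocalRing.residue (closureValuationSubring (v.adicCompletion K))) ≫
          extendPoint (closureValuationSubring (v.adicCompletion K)) (toClosureValuationSubring v)
            R'.model.total
            (R'.modelPointsEquiv.symm (toAdicCompletionPoints Aₐ v (Additive.toMul y)))).left := by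
  haveI := (R'.conjFrob γ hγ p n hq).isProper_model
  haveI := R'.isProper_model
  -- the projected extension `l` of the conjugate-model point: structure map and generic fibre
  have hl₁ := twistPoint_w' (closureValuationSubring (v.adicCompletion K)) (toClosureValuationSubring v)
    (algEquivValuationSubring v γ (smul_asIdeal_eq_of_isArithFrobAt v γ hγ)).toRingHom R'.model.total
    (extendPoint (closureValuationSubring (v.adicCompletion K)) (toClosureValuationSubring v)
      (R'.conjFrob γ hγ p n hq).model.total
      ((R'.conjFrob γ hγ p n hq).modelPointsEquiv.symm
        (toAdicCompletionPoints (Aₐ.conjugate γ.toRingEquiv) v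
          (Additive.toMul (conjTransport γ.toRingEquiv σt hσa Aₐ y)))))
  have hres : Spec.map (CommRingCat.ofHom (algebraMap (closureValuationSubring (v.adicCompletion K))
        (AlgebraicClosure (v.adicCompletion K)))) ≫
      (extendPoint (closureValuationSubring (v.adicCompletion K)) (toClosureValuationSubring v)
          (R'.conjFrob γ hγ p n hq).model.total
          ((R'.conjFrob γ hγ p n hq).modelPointsEquiv.symm
            (toAdicCompletionPoints (Aₐ.conjugate γ.toRingEquiv) v
              (Additive.toMul (conjTransport γ.toRingEquiv σt hσa Aₐ y))))).left =
      ((R'.conjFrob γ hγ p n hq).modelPointsEquiv.symm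
        (toAdicCompletionPoints (Aₐ.conjugate γ.toRingEquiv) v
          (Additive.toMul (conjTransport γ.toRingEquiv σt hσa Aₐ y)))).left :=
    congrArg CommaMorphism.left (restrictPoint_extendPoint (closureValuationSubring (v.adicCompletion K))
      (toClosureValuationSubring v) (R'.conjFrob γ hγ p n hq).model.total
      ((R'.conjFrob γ hγ p n hq).modelPointsEquiv.symm
        (toAdicCompletionPoints (Aₐ.conjugate γ.toRingEquiv) v
          (Additive.toMul (conjTransport γ.toRingEquiv σt hσa Aₐ y)))))
  have hl₂ : Spec.map (CommRingCat.ofHom (algebraMap (closureValuationSubring (v.adicCompletion K))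
        (AlgebraicClosure (v.adicCompletion K)))) ≫
      ((extendPoint (closureValuationSubring (v.adicCompletion K)) (toClosureValuationSubring v)
          (R'.conjFrob γ hγ p n hq).model.total
          ((R'.conjFrob γ hγ p n hq).modelPointsEquiv.symm
            (toAdicCompletionPoints (Aₐ.conjugate γ.toRingEquiv) v
              (Additive.toMul (conjTransport γ.toRingEquiv σt hσa Aₐ y))))).left ≫
        baseChangeHomFst (algEquivValuationSubring v γ (smul_asIdeal_eq_of_isArithFrobAt v γ hγ)).toRingHom
          R'.model.total) =
      Spec.map (CommRingCat.ofHom (absClosureEmbedding K (v.adicCompletion K)).toRingHom) ≫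
        Spec.map (CommRingCat.ofHom σt.toRingHom) ≫
          (Additive.toMul y).left ≫ R'.genericIso'.inv.left ≫
            baseChangeHomFst (algebraMap (valuationSubringAtPrime K v) K) R'.model.total := by
    rw [← Category.assoc, hres]
    exact R'.modelPointsEquiv_symm_conjTransport_left_comp_baseChangeHomFst γ hγ p n hq σt hσa y
  -- the base-point Frobenius translate at `ξ_y`, with (G0)
  have h3 := hT3 R'.model.total _ (R'.xi_comp_hom y)
    (R'.modelPointsEquiv.symm (toAdicCompletionPoints Aₐ v (Additive.toMul y)))
    (R'.modelPointsEquiv_symm_left_eq_xi y) _ hl₁ hl₂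
  rw [Over.comp_left, Category.assoc]
  exact h3

end GoodReductionAt

end AbelianVariety

end Literature.AlgebraicGeometry.Motives

/-! ### (TW) for the produced datum of an abelian-scheme model -/

namespace Literature.NumberTheory.DiophantineGeometry

namespace IsAbelianSchemeModel

open Literature.AlgebraicGeometry.Motives Literature.AlgebraicGeometry.Motives.AbelianVariety
open Literature.NumberTheory.GaloisRepresentations (closureValuationSubring)

variable {F₀ K : Type} [Field F₀] [Field K] [NumberField K] [Algebra F₀ K] {v : HeightOneSpectrum (𝓞 K)}
  {Aₐ : AbelianVariety K} {𝒜ₐ : SchemeOver (valuationSubringAtPrime K v)} [GrpObj 𝒜ₐ]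
  (ha : IsAbelianSchemeModel Aₐ v 𝒜ₐ) (γ : K ≃ₐ[F₀] K) (hγ : IsArithFrobAt (𝓞 F₀) γ v.asIdeal) (p n : ℕ)
  [ExpChar v.asIdeal.ResidueField p] (hq : Nat.card (𝓞 F₀ ⧸ v.asIdeal.under (𝓞 F₀)) = p ^ n)
  (σt : AlgebraicClosure K ≃+* AlgebraicClosure K)
  (hσa : ∀ a : K, σt (algebraMap K (AlgebraicClosure K) a) = algebraMap K (AlgebraicClosure K) (γ.toRingEquiv a))

/-- **(TW) — the twisted reduction identity, ASSEMBLED** ([Shimura1998] §18.6 p. 129 «`(Y^σ)~ = Ỹ^f` … `(t^σ)~ = π(t̃)`»):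
for every `y ∈ Aₐ(K̄)`, the reduction map of the Frobenius-conjugate datum `(ha.goodReductionAt).conjFrob γ hγ p n hq` at
the `σ̃`-conjugate point `y^σ̃ ∈ Aₐ^γ(K̄)` is the relative `pⁿ`-Frobenius `π` of the reduction `red_v y` — modulo the base-point
Frobenius-translate predicate `SlotT3`; with (P4) (`reductionPoint_conjOfSquares_eq_relFrobenius`) and (C)
(`geomReductionMap_goodReductionAt`) proved. [cite: Shimura1998, §18.6 proof of Thm. 18.6, p. 129] -/
theorem twistedReductionMap_of_slotT3
    [ExpChar (IsLocalRing.ResidueField (closureValuationSubring (v.adicCompletion K))) p]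
    (hT3 : GoodReductionAt.SlotT3 v (algEquivValuationSubring v γ (smul_asIdeal_eq_of_isArithFrobAt v γ hγ)).toRingHom
      σt p n)
    (y : Aₐ.geomPoints) :
    (ha.goodReductionAt.conjFrob γ hγ p n hq).geomReductionMap (conjTransport γ.toRingEquiv σt hσa Aₐ y) =
      Hom.geomPointsMap (ha.specialFibre.relFrobenius p n) (ha.specialFibreReductionHom y) := by
  rw [← ha.geomReductionMap_goodReductionAt y]
  -- both sides are `reductionPoint`s of «extend then restrict» points (by the definition of `geomReductionMap`)
  exact GoodReductionAt.reductionPoint_conjOfSquares_eq_relFrobenius ha.goodReductionAt γ.toRingEquiv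
    (algEquivValuationSubring v γ (smul_asIdeal_eq_of_isArithFrobAt v γ hγ))
    (algebraMap_comp_algEquivValuationSubring v γ _) p n
    (residueAt_comp_algEquivValuationSubring v γ hγ p n hq) _ _
    (ha.goodReductionAt.reduce_conjTransport_left_comp_fst γ hγ p n hq σt hσa hT3 y)

end IsAbelianSchemeModel

end Literature.NumberTheory.DiophantineGeometry

end
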